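import Literature.AlgebraicGeometry.Resolution.BoundaryEquivalence
import Literature.AlgebraicGeometry.Resolution.BlowupSNC
import Literature.AlgebraicGeometry.Resolution.MarkedIdealsEtale
import HarnessLib

/-!
# Simple normal crossings with a second centre persist under a blow-up away from it

Topic: `Literature/AlgebraicGeometry/Resolution`. Bookkeeping for RE-SEQUENCING a blow-up along a regular but
reducible centre `V(C) = Z₁ ⊔ ⋯ ⊔ Z_k` into the successive blow-ups along its pairwise disjoint pieces
(Bierstone–Grigoriev–Milman–Włodarczyk 2011, §4 Step 2b: «we can randomly pick any maximal irreducible component of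
`supp(𝓘, μ)`»; Stacks 080A / the tree's `IsBlowup.comp`): after the blow-up `π : X' → X` along the FIRST piece
`C₁`, the remaining pieces — pulled back along `π`, which is an isomorphism over `X ∖ V(C₁)` (Stacks 02OS) — must
again have simple normal crossings (BGMW Def. 3.1.3 (2)) with the transformed boundary
`E' = (strict transforms of E) ++ [exceptional divisor]` (BGMW Def. 3.1.3 (4); Kollár 2007, Def. 3.25).

* `HasSNCWith.transform_comap_of_disjoint` — **for `π` a blow-up of `X` along `C₁`, a boundary `E` having simple
  normal crossings with `C₁` AND with a second centre `C'` whose support is disjoint from `V(C₁)`, the transformed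
  boundary `E.map (strictTransformIdeal π C₁) ++ [C₁.comap π]` has simple normal crossings with `C'.comap π`.**
  Pointwise: over `V(C₁)` the pulled-back centre is trivial and the transformed boundary is snc by the tree's
  `HasSNCWith.hasSNC_transform` (Kollár Def. 3.25); off `V(C₁)` the stalk map `𝒪_{X, π x'} → 𝒪_{X', x'}` is an
  isomorphism (`IsBlowup.isIso_stalkMap_of_not_mem_support`), the members of `E'` through `x'` are the strict
  transforms of the members of `E` through `π x'` with stalks `K_{π x'} · 𝒪_{X', x'}`
  (`stalkIdeal_strictTransformIdeal_of_not_mem_support`), `(C'.comap π)_{x'} = C'_{π x'} · 𝒪_{X', x'}`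
  (`stalkIdeal_comap_eq_map`), and a regular system of parameters adapted to `E` and `C'` at `π x'` transports.

## Sources

* E. Bierstone, D. Grigoriev, P. Milman, J. Włodarczyk, arXiv:1206.3090, Def. 3.1.3 (2), (4) (p. 6); §4 Step 2b
  (p. 13). [BierstoneGrigorievMilmanWlodarczyk2011]
* J. Kollár, *Lectures on Resolution of Singularities* (2007), Def. 3.24–3.25. [Kollar2007]
* The Stacks Project, Tag 02OS (a blow-up is an isomorphism away from the centre), Tag 080A. [StacksProject]
-/

noncomputable section

open CategoryTheory AlgebraicGeometry TopologicalSpace IsLocalRing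

namespace Literature.AlgebraicGeometry.Resolution

universe u

variable {X X' : Scheme.{u}} [IsLocallyNoetherian X] [IsLocallyNoetherian X'] {π : X' ⟶ X}
  {C₁ C' : X.IdealSheafData} {E : List X.IdealSheafData}

/-- **Simple normal crossings with a disjoint second centre persist under a blow-up** (BGMW Def. 3.1.3 (2), (4);
Kollár Def. 3.25, for the re-sequencing of a reducible regular centre into its pieces, BGMW §4 Step 2b): if `π`
is a blow-up of `X` along `C₁`, the boundary `E` has simple normal crossings with `C₁` and with `C'`, and
`V(C') ∩ V(C₁) = ∅`, then the transformed boundary `E.map (strictTransformIdeal π C₁) ++ [C₁.comap π]` has simple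
normal crossings with the pulled-back centre `C'.comap π`.
[cite: BierstoneGrigorievMilmanWlodarczyk2011, Def. 3.1.3 (2), (4); §4 Step 2b] [cite: Kollar2007, Def. 3.25] -/
theorem HasSNCWith.transform_comap_of_disjoint (hπ : IsBlowup π C₁) (h₁ : HasSNCWith E C₁)
    (h' : HasSNCWith E C') (hdisj : Disjoint (C₁.support : Set X) (C'.support : Set X)) :
    HasSNCWith (E.map (strictTransformIdeal π C₁) ++ [C₁.comap π]) (C'.comap π) := by
  classical
  intro x'
  by_cases hxC : π x' ∈ C₁.support
  · -- over the first centre: the second centre is absent, the transformed boundary is snc (Kollár Def. 3.25)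
    obtain ⟨hreg, u, hu, hE, -⟩ := h₁.hasSNC_transform hπ x'
    refine ⟨hreg, u, hu, hE, fun hx' => ?_⟩
    exfalso
    rw [Scheme.IdealSheafData.support_comap] at hx'
    exact Set.disjoint_left.mp hdisj hxC hx'
  · -- off the first centre: transport along the stalk isomorphism `𝒪_{X, π x'} ≅ 𝒪_{X', x'}`
    haveI := hπ.isIso_stalkMap_of_not_mem_support hxC
    let e : X.presheaf.stalk (π x') ≃+* X'.presheaf.stalk x' := (asIso (π.stalkMap x')).commRingCatIsoToRingEquiv
    have he : (e : X.presheaf.stalk (π x') →+* X'.presheaf.stalk x') = (π.stalkMap x').hom := rfl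
    obtain ⟨hreg, u, hu, ⟨ι, hι, hιD⟩, hC⟩ := h' (π x')
    haveI := hreg
    haveI hreg' : IsRegularLocalRing (X'.presheaf.stalk x') := IsRegularLocalRing.of_ringEquiv e
    refine ⟨hreg', ?_⟩
    -- the embedding dimensions agree
    have hrank : (maximalIdeal (X'.presheaf.stalk x')).spanFinrank =
        (maximalIdeal (X.presheaf.stalk (π x'))).spanFinrank := by
      rw [← map_ringEquiv_maximalIdeal e, Ideal.spanFinrank_map_eq_of_ringEquiv]
    let σ : Fin (maximalIdeal (X'.presheaf.stalk x')).spanFinrank ≃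
        Fin (maximalIdeal (X.presheaf.stalk (π x'))).spanFinrank := finCongr hrank
    let u' : Fin (maximalIdeal (X'.presheaf.stalk x')).spanFinrank → X'.presheaf.stalk x' :=
      fun i => e (u (σ i))
    have hu'σ : ∀ j, u' (σ.symm j) = e (u j) := fun j => by
      simp only [u', Equiv.apply_symm_apply]
    refine ⟨u', ?_, ?_, ?_⟩
    · -- `(u') = 𝔪_{x'}`
      have hr : Set.range u' = e '' Set.range u := by
        rw [show u' = (fun j => e (u j)) ∘ σ from rfl, σ.surjective.range_comp]
        exact Set.range_comp _ u
      rw [hr, ← Ideal.map_span e, hu, map_ringEquiv_maximalIdeal]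
    · -- the members of the transformed boundary through `x'` are strict transforms of members of `E` through `π x'`
      have key : ∀ D' : {D' // D' ∈ E.map (strictTransformIdeal π C₁) ++ [C₁.comap π] ∧ x' ∈ D'.support},
          ∃ D : {D // D ∈ E ∧ π x' ∈ D.support}, strictTransformIdeal π C₁ D.1 = D'.1 := by
        rintro ⟨D', hD'E, hx'⟩
        rcases mem_transform_boundary_cases hD'E hx' with h | ⟨D, hDE, hxD, hD⟩
        · exfalso
          apply hxC
          have : x' ∈ (C₁.comap π).support := h ▸ hx'
          rwa [Scheme.IdealSheafData.support_comap] at this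
        · exact ⟨⟨D, hDE, hxD⟩, hD⟩
      choose g hg using key
      refine ⟨fun D' => σ.symm (ι (g D')), ?_, ?_⟩
      · intro D₁ D₂ heq
        have h2 : g D₁ = g D₂ := hι (σ.symm.injective heq)
        apply Subtype.ext
        rw [← hg D₁, ← hg D₂, h2]
      · intro D'
        rw [hu'σ, ← hg D', stalkIdeal_strictTransformIdeal_of_not_mem_support C₁ (g D').1 hxC, ← he,
          hιD (g D'), Ideal.map_span, Set.image_singleton]
        rfl
    · -- the second centre
      intro hx'
      rw [Scheme.IdealSheafData.support_comap] at hx'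
      obtain ⟨S, hS⟩ := hC hx'
      refine ⟨σ ⁻¹' S, ?_⟩
      rw [stalkIdeal_comap_eq_map, ← he, hS, Ideal.map_span, Set.image_image]
      congr 1
      rw [show u' = (fun j => e (u j)) ∘ σ from rfl, Set.image_comp, σ.image_preimage]
      rfl

end Literature.AlgebraicGeometry.Resolution

end
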